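import Mathlib
import Literature.Analysis.FluidPDE.SelfSimilarCollapseAnsatz
import Summits.NavierStokesRegularity.NavierStokesRegularity.Theorems.EulerZoomLiouvillePowerGaugeEulerLiouvilleSelfSimilarCountableNodalSet
import HarnessLib.Audit

/-!
# Rung C1 of the crux `EulerZoomLiouville.PowerGaugeEulerLiouville`: the nodal-countability exclusion
# in the ROUTE'S variables (exponent `γ = 1/(2+ρ)`, centre `0`) and at MEMBER level

Route №10 `EulerZoomLiouville` (NavierStokesRegularity), crux E = stmt-NavierStokesRegularity-19832,
tenure rung C1 (exactly self-similar members), registered residue `stub_selfSimilarExtremal` (skeleton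
`Lines/birth.lean`: `IsExactlySelfSimilar ρ u p V P` = `u τ = selfSimilarCollapse (1/(2+ρ)) 0 V τ`, …).
Ninth file of the NODAL-FINITENESS chain (lineage ns-typeII-p2, gen 6): the binder shapes used by the
lineage's member-level strata (`…SelfSimilarOutgoingNodes`), now for the countability exclusion.

* `selfSimilar_profile_eq_zero_of_countable_nodalSet` — **for every `ρ > 0`: a classical (`C²`)
  stationary self-similar Euler profile with the class exponent `1/(2+ρ)` and CIV's far-field bounds
  (3.8) whose transport field `y/(2+ρ) + V` has COUNTABLY many stagnation points is `≡ 0`**;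
  `…_of_finite_nodalSet`: the finite case.
* `selfSimilar_ae_eq_zero_of_countable_nodalSet` — MEMBER LEVEL: an exactly self-similar member
  `u(τ) = selfSimilarCollapse (1/(2+ρ)) 0 V τ` with such a profile vanishes a.e. on `(−∞,0) × ℝ³`
  (a stratum of `stub_selfSimilarExtremal`: classical profiles with countable nodal set — no crux
  hypothesis is even needed for this stratum, the profile itself is zero).
* `selfSimilar_not_countable_nodalSet_of_ne_zero` — REFUTER-FACING PORTRAIT: a NONTRIVIAL classical
  in-window profile with (3.8) has UNCOUNTABLY many stagnation points (so CIV's Definition 3.7, which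
  starts "the nodal set is finite", fails for every candidate — the lineage's landed
  `not_isLocallyOutgoing_of_ne_zero`, now independently of the outgoing inequality).

WHAT THIS IS NOT: not NS, not E, not rung C1 — classical profiles; the weak-class residue and profiles
whose stagnation set is a continuum (curves, surfaces) are untouched.

## References

* P. Constantin, M. Ignatova, V. Vicol, arXiv:2602.17570 (2026), §3.5 Def 3.7, Thm 3.10.
  [ConstantinIgnatovaVicol2026Putative]
-/

noncomputable section

-- flat `Theorems/<Route><Decl>…` files of one crux share the namespace of the crux (tree convention)
set_option linter.dupNamespace false

open MeasureTheory Set Filter Topology Metric Function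
open scoped NNReal

namespace Summit.NavierStokesRegularity.NavierStokesRegularity.Theorems.PowerGaugeEulerLiouville

open Literature.Analysis Literature.Analysis.FluidPDE

/-- **Rung C1, the «countable stagnation set» stratum (every `ρ > 0`), profile level.** A classical
stationary self-similar Euler profile with the class exponent `1/(2+ρ)` and CIV's far-field bounds (3.8)
whose self-similar transport field `y/(2+ρ) + V` has only countably many stagnation points is
identically zero. [cite: ConstantinIgnatovaVicol2026Putative, §3.5 Thm 3.10 (countable nodal set; outgoing inequality and analyticity removed)] -/
theorem selfSimilar_profile_eq_zero_of_countable_nodalSet {ρ : ℝ} (hρ : 0 < ρ)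
    {V : EuclideanSpace ℝ (Fin 3) → EuclideanSpace ℝ (Fin 3)} {P : EuclideanSpace ℝ (Fin 3) → ℝ}
    (hprof : IsSelfSimilarEulerProfile (1 / (2 + ρ)) 0 V P)
    (hfar : HasSelfSimilarFarField (1 / (2 + ρ)) 0 V)
    (hN : (selfSimilarNodalSet (1 / (2 + ρ)) 0 V).Countable) : V = 0 := by
  obtain ⟨C, hC⟩ := hfar
  exact NodalFiniteness.eq_zero_of_countable_nodalSet_of_exponent hρ hprof hC hN

/-- **The «finite stagnation set» stratum, profile level** (special case).
[cite: ConstantinIgnatovaVicol2026Putative, §3.5 Thm 3.10 (finite nodal set; outgoing inequality and analyticity removed)] -/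
theorem selfSimilar_profile_eq_zero_of_finite_nodalSet {ρ : ℝ} (hρ : 0 < ρ)
    {V : EuclideanSpace ℝ (Fin 3) → EuclideanSpace ℝ (Fin 3)} {P : EuclideanSpace ℝ (Fin 3) → ℝ}
    (hprof : IsSelfSimilarEulerProfile (1 / (2 + ρ)) 0 V P)
    (hfar : HasSelfSimilarFarField (1 / (2 + ρ)) 0 V)
    (hN : (selfSimilarNodalSet (1 / (2 + ρ)) 0 V).Finite) : V = 0 :=
  selfSimilar_profile_eq_zero_of_countable_nodalSet hρ hprof hfar hN.countable

/-- **Rung C1, the «countable stagnation set» stratum, MEMBER LEVEL.** An exactly self-similar member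
`u(τ) = selfSimilarCollapse (1/(2+ρ)) 0 V τ` (`τ < 0`) whose profile is classical with CIV's far
field and has countably many stagnation points vanishes a.e. on `(−∞, 0) × ℝ³` (indeed the profile is
zero).  Binder shape of the lineage's member-level strata. [cite: ConstantinIgnatovaVicol2026Putative, §3.5 Thm 3.10 (countable nodal set; outgoing inequality and analyticity removed)] -/
theorem selfSimilar_ae_eq_zero_of_countable_nodalSet {ρ : ℝ} (hρ : 0 < ρ)
    (u : ℝ → EuclideanSpace ℝ (Fin 3) → EuclideanSpace ℝ (Fin 3))
    (V : EuclideanSpace ℝ (Fin 3) → EuclideanSpace ℝ (Fin 3)) (P : EuclideanSpace ℝ (Fin 3) → ℝ)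
    (hu : ∀ τ : ℝ, τ < 0 → u τ = selfSimilarCollapse (1 / (2 + ρ)) 0 V τ)
    (hprof : IsSelfSimilarEulerProfile (1 / (2 + ρ)) 0 V P)
    (hfar : HasSelfSimilarFarField (1 / (2 + ρ)) 0 V)
    (hN : (selfSimilarNodalSet (1 / (2 + ρ)) 0 V).Countable) :
    uncurry u =ᵐ[volume.restrict (Iio (0 : ℝ) ×ˢ (univ : Set (EuclideanSpace ℝ (Fin 3))))] 0 := by
  have hV0 : V = 0 := selfSimilar_profile_eq_zero_of_countable_nodalSet hρ hprof hfar hN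
  have hS : MeasurableSet (Iio (0 : ℝ) ×ˢ (univ : Set (EuclideanSpace ℝ (Fin 3)))) :=
    measurableSet_Iio.prod MeasurableSet.univ
  refine (ae_restrict_mem hS).mono fun z hz => ?_
  obtain ⟨hτ, -⟩ := hz
  have hτ' : z.1 < 0 := hτ
  change u z.1 z.2 = 0
  rw [hu z.1 hτ', hV0, selfSimilarCollapse_zero]
  rfl

/-- **MEMBER LEVEL, finite stagnation set** (special case). [cite: ConstantinIgnatovaVicol2026Putative, §3.5 Thm 3.10 (finite nodal set; outgoing inequality and analyticity removed)] -/
theorem selfSimilar_ae_eq_zero_of_finite_nodalSet {ρ : ℝ} (hρ : 0 < ρ)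
    (u : ℝ → EuclideanSpace ℝ (Fin 3) → EuclideanSpace ℝ (Fin 3))
    (V : EuclideanSpace ℝ (Fin 3) → EuclideanSpace ℝ (Fin 3)) (P : EuclideanSpace ℝ (Fin 3) → ℝ)
    (hu : ∀ τ : ℝ, τ < 0 → u τ = selfSimilarCollapse (1 / (2 + ρ)) 0 V τ)
    (hprof : IsSelfSimilarEulerProfile (1 / (2 + ρ)) 0 V P)
    (hfar : HasSelfSimilarFarField (1 / (2 + ρ)) 0 V)
    (hN : (selfSimilarNodalSet (1 / (2 + ρ)) 0 V).Finite) :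
    uncurry u =ᵐ[volume.restrict (Iio (0 : ℝ) ×ˢ (univ : Set (EuclideanSpace ℝ (Fin 3))))] 0 :=
  selfSimilar_ae_eq_zero_of_countable_nodalSet hρ u V P hu hprof hfar hN.countable

/-- **The refuter-facing portrait (every `ρ > 0`).** A NONTRIVIAL classical self-similar Euler profile
with the class exponent `1/(2+ρ)` and CIV's far-field bounds (3.8) has UNCOUNTABLY many stagnation
points of `y/(2+ρ) + V`; in particular CIV's Definition 3.7 (finite nodal set) fails for it.
[cite: ConstantinIgnatovaVicol2026Putative, §3.5 Def 3.7, Thm 3.10 (sharpened; not in print)] -/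
theorem selfSimilar_not_countable_nodalSet_of_ne_zero {ρ : ℝ} (hρ : 0 < ρ)
    {V : EuclideanSpace ℝ (Fin 3) → EuclideanSpace ℝ (Fin 3)} {P : EuclideanSpace ℝ (Fin 3) → ℝ}
    (hprof : IsSelfSimilarEulerProfile (1 / (2 + ρ)) 0 V P)
    (hfar : HasSelfSimilarFarField (1 / (2 + ρ)) 0 V) (hV : V ≠ 0) :
    ¬ (selfSimilarNodalSet (1 / (2 + ρ)) 0 V).Countable :=
  fun hN => hV (selfSimilar_profile_eq_zero_of_countable_nodalSet hρ hprof hfar hN)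

end Summit.NavierStokesRegularity.NavierStokesRegularity.Theorems.PowerGaugeEulerLiouville
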